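import Literature.Computability.AlgebraicComplexity.BLMW11WeakValiantHypothesis
import Literature.Computability.AlgebraicComplexity.VBPClosedUnderComposition
import Literature.Computability.AlgebraicComplexity.BLMW11FormulasWeaklySkew
import HarnessLib

/-!
# `VBP = VP_ws` is the class of families of p-bounded determinantal complexity, over every
# commutative ring; Bürgisser 2024, Cor. 2.33 over every field of characteristic `≠ 2` — PROOFS

Topic `Computability/AlgebraicComplexity`. Cell `val-lit`, row Bur2024-A (P. Bürgisser,
*Completeness classes in algebraic complexity theory*, arXiv:2406.06217, 2024), §2.9
(held text `paper:arxiv-2406.06217`, p0012 L91–L94) and §2.7 Cor. 2.33 (p0011 L109–L110):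

> **Corollary 2.33.** Suppose `char 𝔽 ≠ 2`. Then `VBP ≠ VNP` iff `PER` is not a `p`-projection of
> `DET`.
>
> (§2.9) the separation `VBP ≠ VNP` is equivalent to proving that `dc(n) := dc(PER_n)` is not
> polynomially bounded (if `char 𝔽 ≠ 2`).

The tree holds these over `ℂ` (`vnp_subset_vpws_iff_isPProjection_perPoly_detPoly`,
`isVPwsFamily_perPoly_iff_isPBounded_dc`, `dcPerSuperpolynomial_iff_not_vnp_subset_vpws`,
`BLMW11WeakValiantHypothesis.lean` — through the `ℂ`-only `wsComplexity_le_of_hasDetRepr`). With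
the commutative-ring universality of the determinant for arbitrary variable types
(`isPProjection_detPoly_of_isVPwsFamily`, `IMMCompleteness.lean`) and the commutative-ring
`wsComplexity_le_of_hasDetRepr'` (`VBPClosedUnderComposition.lean`) the printed generality is
reached:

* `isPBounded_determinantalComplexity_of_isVPwsFamily`,
  `isVPwsFamily_of_isPBounded_determinantalComplexity`,
  **`isVPwsFamily_iff_isPBounded_determinantalComplexity`** — over every commutative ring, a family
  in p-boundedly many variables is in `VBP = VP_ws` iff its determinantal complexity is p-bounded
  (`VBP = VP_dc`; BLMW 2011 §9.2, Bürgisser 2024 §2.9);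
* `isVPwsFamily_perPoly_iff_isPBounded_determinantalComplexity`,
  `dcPerSuperpolynomial_iff_not_isVPwsFamily_perPoly_field` — `(PER_n) ∈ VBP ⟺ dc(PER_n)`
  p-bounded, every commutative ring / field;
* **`Bur24_cor_2_19`** — over every commutative ring and for families in arbitrary variable
  types: `(DET_n) ∈ VF ⟺ VF = VBP` (Cor. 2.19 (2) ⟺ (3); the tree's
  `vpe_eq_vpws_iff_isPBounded_formulaComplexity_detPoly` is `k = ℂ`, `Fin (v n)`-indexed);
* **`Bur24_cor_2_33`** — over every field of characteristic `≠ 2`: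
  `VNP ⊆ VBP ⟺ (PER_n)` is a p-projection of `(DET_n)`; and the §2.9 form
  **`dcPerSuperpolynomial_iff_not_vnp_subset_vpws_of_ringChar_ne_two`**:
  `dc(PER_n)` not p-bounded `⟺ VNP ⊄ VBP`.

Ingredients: Valiant's completeness of the permanent in characteristic `≠ 2`
(`isVNPComplete_perPoly_holds`), `PER ∈ VNP` (`isVNPFamily_perPoly_holds`), `DET ∈ VP_ws`
(`HI16Skew.isVPwsFamily_detPoly`), closure of `VP_ws` under p-projections
(`IsVPwsFamily.of_isPProjection`), skew universality (`hasDetRepr_of_wsComplexity_le_of_skew_le_ws`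
with `ArithCircuit.skewComplexity_le_four_mul_wsComplexity`), attainment of `dc`
(`hasDetRepr_determinantalComplexity_holds`). Theorems only; no definitions, no named facts
(D-0026). Honest framing: equivalences between OPEN statements; `VP ≠ VNP` (and `VBP ≠ VNP`) are
NOT proved and nothing here bears on their truth.

## References

* [Burgisser2024Completeness] P. Bürgisser, *Completeness classes in algebraic complexity
  theory*, arXiv:2406.06217 (2024), Cor. 2.33 (p0011 L109–L110), §2.9 (p0012 L91–L94).
* [BurgisserEtAl2011] Bürgisser–Landsberg–Manivel–Weyman, SIAM J. Comput. 40 (2011), §9.2.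
* [Valiant1979] L. G. Valiant, *Completeness classes in algebra*, STOC 1979.
-/

noncomputable section

open MvPolynomial

namespace Literature.Computability.AlgebraicComplexity

universe u

/-! ## `VBP = VP_dc` over every commutative ring -/

section DcClass

variable {k : Type u} [CommRing k] {σ : ℕ → Type} [∀ n, Fintype (σ n)]

/-- **A `VP_ws` family has p-bounded determinantal complexity** (every commutative ring, any
finite variable types): `L_ws(f_n) ≤ r` gives `dc(f_n) ≤ 12 r + 1` by skew universality
(`hasDetRepr_of_wsComplexity_le_of_skew_le_ws`, `L_skew ≤ 4 L_ws`).
[cite: BurgisserEtAl2011, §9.2 (universality of the determinant)] -/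
theorem isPBounded_determinantalComplexity_of_isVPwsFamily {f : ∀ n, MvPolynomial (σ n) k}
    (hf : IsVPwsFamily f) : IsPBounded fun n => determinantalComplexity (f n) := by
  obtain ⟨c, hc⟩ := hf
  refine IsPBounded.mono (t := fun m => 3 * (4 * (m ^ c + c)) + 1)
    (IsPBounded.add_holds (IsPBounded.mul_holds (IsPBounded.const 3) (IsPBounded.mul_holds
      (IsPBounded.const 4) (IsPBounded.add_holds (IsPBounded.pow_holds IsPBounded.id c)
      (IsPBounded.const c)))) (IsPBounded.const 1)) fun m => ?_
  exact determinantalComplexity_le_of_hasDetRepr (hasDetRepr_of_wsComplexity_le_of_skew_le_ws 4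
    (fun g => ArithCircuit.skewComplexity_le_four_mul_wsComplexity g) (f m) (hc m))

variable [∀ n, DecidableEq (σ n)]

/-- **A family of p-bounded determinantal complexity in p-boundedly many variables is a `VP_ws`
family** (every commutative ring): an affine determinantal representation of size `dc(f_n)` is an
affine substitution into the skew circuit of `det` (`wsComplexity_le_of_hasDetRepr'`).
[cite: BurgisserEtAl2011, §9.1–§9.2 (det ∈ VP_ws; universality of the determinant)] -/
theorem isVPwsFamily_of_isPBounded_determinantalComplexity {f : ∀ n, MvPolynomial (σ n) k}
    (hσ : IsPBounded fun n => Fintype.card (σ n))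
    (hf : IsPBounded fun n => determinantalComplexity (f n)) : IsVPwsFamily f := by
  obtain ⟨c, hc⟩ := hf
  have hr : IsPBounded fun m => m ^ c + c :=
    IsPBounded.add_holds (IsPBounded.pow_holds IsPBounded.id c) (IsPBounded.const c)
  refine IsPBounded.mono (t := fun m => (((m ^ c + c) + 2) * (4 * (m ^ c + c) ^ 3 + 7) ^ 2 +
      (m ^ c + c) * (m ^ c + c)) * (2 * Fintype.card (σ m) + 3)) ?_ fun m => ?_
  · exact IsPBounded.mul_holds (IsPBounded.add_holds (IsPBounded.mul_holds
      (IsPBounded.add_holds hr (IsPBounded.const 2)) (IsPBounded.pow_holds (IsPBounded.add_holds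
      (IsPBounded.mul_holds (IsPBounded.const 4) (IsPBounded.pow_holds hr 3)) (IsPBounded.const 7))
      2)) (IsPBounded.mul_holds hr hr)) (IsPBounded.add_holds (IsPBounded.mul_holds
      (IsPBounded.const 2) hσ) (IsPBounded.const 3))
  · have hrepr : HasDetRepr (f m) (m ^ c + c) :=
      HasDetRepr.mono_holds (hasDetRepr_determinantalComplexity_holds _) (hc m)
    exact wsComplexity_le_of_hasDetRepr' hrepr

/-- **`VBP = VP_ws` is the class of families of p-bounded determinantal complexity** (in
p-boundedly many variables, over every commutative ring; BLMW 2011 §9.2 / Bürgisser 2024 §2.9: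
the equivalence behind "`VBP ≠ VNP` iff `dc(PER_n)` is not polynomially bounded").
[cite: Burgisser2024Completeness, §2.9 (p0012 L91–L94)] -/
theorem isVPwsFamily_iff_isPBounded_determinantalComplexity {f : ∀ n, MvPolynomial (σ n) k}
    (hσ : IsPBounded fun n => Fintype.card (σ n)) :
    IsVPwsFamily f ↔ IsPBounded fun n => determinantalComplexity (f n) :=
  ⟨isPBounded_determinantalComplexity_of_isVPwsFamily,
    isVPwsFamily_of_isPBounded_determinantalComplexity hσ⟩

/-- **`(PER_n) ∈ VBP ⟺ dc(PER_n)` is p-bounded**, over every commutative ring (the tree's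
`isVPwsFamily_perPoly_iff_isPBounded_dc` is the case `k = ℂ`).
[cite: Burgisser2024Completeness, §2.9 (p0012 L91–L94)] -/
theorem isVPwsFamily_perPoly_iff_isPBounded_determinantalComplexity (k : Type u) [CommRing k] :
    IsVPwsFamily (fun m => perPoly (Fin m) k) ↔
      IsPBounded fun m => determinantalComplexity (perPoly (Fin m) k) :=
  isVPwsFamily_iff_isPBounded_determinantalComplexity
    (IsPBounded.mono (IsPBounded.mul_holds IsPBounded.id IsPBounded.id) fun m => by simp)

end DcClass

/-! ## Cor. 2.33 over every field of characteristic `≠ 2` -/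

section Fields

variable (k : Type u) [Field k]

/-- **`DcPerSuperpolynomial k ⟺ (PER_n) ∉ VBP`** over every field (the tree's
`dcPerSuperpolynomial_iff_not_isVPwsFamily_perPoly` is `k = ℂ`).
[cite: Burgisser2024Completeness, §2.9 (p0012 L91–L94)] -/
theorem dcPerSuperpolynomial_iff_not_isVPwsFamily_perPoly_field :
    DcPerSuperpolynomial k ↔ ¬ IsVPwsFamily (fun m => perPoly (Fin m) k) := by
  unfold DcPerSuperpolynomial
  rw [isVPwsFamily_perPoly_iff_isPBounded_determinantalComplexity]

/-- `(PER_n) ∈ VBP ⟺ (PER_n)` is a p-projection of `(DET_n)`, over every commutative ring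
(`isVPwsFamily_iff`-type instance of `isPProjection_detPoly_of_isVPwsFamily` /
`IsVPwsFamily.of_isPProjection`). [cite: Burgisser2024Completeness, Thm. 2.20] -/
theorem isVPwsFamily_perPoly_iff_isPProjection_detPoly_ring (R : Type u) [CommRing R] :
    IsVPwsFamily (fun m => perPoly (Fin m) R) ↔
      IsPProjection (fun m => perPoly (Fin m) R) (fun n => detPoly (Fin n) R) :=
  ⟨isPProjection_detPoly_of_isVPwsFamily, fun h => (HI16Skew.isVPwsFamily_detPoly R).of_isPProjection h⟩

/-- **Bürgisser 2024, Cor. 2.33, in the form `VNP ⊆ VBP ⟺ PER ≤_p DET`, over every field of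
characteristic `≠ 2`** ("Suppose `char 𝔽 ≠ 2`. Then `VBP ≠ VNP` iff `PER` is not a
`p`-projection of `DET`"; `VNP` families in variables `Fin (v n)` as in the tree's
`IsVNPComplete`): `⇒` by `PER ∈ VNP` (`isVNPFamily_perPoly_holds`, variables re-indexed along
`Fin n × Fin n ≃ Fin (n·n)`) and the universality of `DET` for `VP_ws`
(`isPProjection_detPoly_of_isVPwsFamily`); `⇐` by Valiant's `VNP`-completeness of `PER` in
characteristic `≠ 2` (`isVNPComplete_perPoly_holds`), `DET ∈ VP_ws` and the closure of `VP_ws`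
under p-projections. [cite: Burgisser2024Completeness, Cor. 2.33] -/
theorem Bur24_cor_2_33 (h2 : ringChar k ≠ 2) :
    (∀ (v : ℕ → ℕ) (f : ∀ n, MvPolynomial (Fin (v n)) k), IsVNPFamily f → IsVPwsFamily f) ↔
      IsPProjection (fun m => perPoly (Fin m) k) (fun n => detPoly (Fin n) k) := by
  rw [← isVPwsFamily_perPoly_iff_isPProjection_detPoly_ring]
  constructor
  · intro H
    have hvnp : IsVNPFamily (fun n => rename (finProdFinEquiv (m := n) (n := n))
        (perPoly (Fin n) k)) := by
      have h := (isVNPFamily_renameEquiv_iff (σ := fun n => Fin n × Fin n)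
        (fun n => finProdFinEquiv (m := n) (n := n)) (fun n => perPoly (Fin n) k)).2
        (isVNPFamily_perPoly_holds k)
      simpa only [renameEquiv_apply] using h
    have h := H (fun n => n * n) _ hvnp
    unfold IsVPwsFamily at h ⊢
    simpa only [wsComplexity_rename_equiv] using h
  · intro hper v f hf
    exact IsVPwsFamily.of_isPProjection hper (((isVNPComplete_perPoly_holds k) h2).2 v f hf)

/-- **Bürgisser 2024, §2.9 / Cor. 2.33: `dc(PER_n)` is not polynomially bounded
`⟺ VNP ⊄ VBP`**, over every field of characteristic `≠ 2` (the tree's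
`dcPerSuperpolynomial_iff_not_vnp_subset_vpws` is `k = ℂ`).
[cite: Burgisser2024Completeness, §2.9 (p0012 L91–L94)] -/
theorem dcPerSuperpolynomial_iff_not_vnp_subset_vpws_of_ringChar_ne_two (h2 : ringChar k ≠ 2) :
    DcPerSuperpolynomial k ↔
      ¬ ∀ (v : ℕ → ℕ) (f : ∀ n, MvPolynomial (Fin (v n)) k), IsVNPFamily f → IsVPwsFamily f := by
  rw [dcPerSuperpolynomial_iff_not_isVPwsFamily_perPoly_field,
    isVPwsFamily_perPoly_iff_isPProjection_detPoly_ring, Bur24_cor_2_33 k h2]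

end Fields

/-! ## Cor. 2.19 over every commutative ring -/

section Formulas

variable (k : Type u) [CommRing k]

/-- **`VBP ⊆ VF ⟺ (DET_n)` has p-bounded formula size**, over every commutative ring and for
families in arbitrary variable types (`⇐`: a `VP_ws` family is a p-projection of `(DET_n)`,
`isPProjection_detPoly_of_isVPwsFamily`, and `VF` is closed under p-projections,
`isPBounded_formulaComplexity_of_isPProjection`; `⇒`: `(DET_n) ∈ VP_ws`,
`HI16Skew.isVPwsFamily_detPoly`). [cite: Burgisser2024Completeness, Cor. 2.19] -/
theorem vbp_subset_vf_iff_isPBounded_formulaComplexity_detPoly :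
    (∀ {σ : ℕ → Type} (f : ∀ n, MvPolynomial (σ n) k), IsVPwsFamily f →
        IsPBounded fun n => formulaComplexity (f n)) ↔
      IsPBounded fun n => formulaComplexity (detPoly (Fin n) k) :=
  ⟨fun h => h _ (HI16Skew.isVPwsFamily_detPoly k),
    fun hdet _ _ hf => isPBounded_formulaComplexity_of_isPProjection hdet
      (isPProjection_detPoly_of_isVPwsFamily hf)⟩

/-- **Bürgisser 2024, Corollary 2.19 ((2) ⟺ (3)): "`DET ∈ VF`" iff "`VF = VBP`"**, over every
commutative ring, `VF` rendered (as elsewhere in the tree) by p-bounded formula size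
`IsPBounded (E ∘ f)` and `VBP = VP_ws` by `IsVPwsFamily`, for families in arbitrary variable
types; `VF ⊆ VBP` is unconditional (`IsVPwsFamily.of_isPBounded_formulaComplexity`: formulas are
weakly skew). Statement (1) of the corollary, "`DET_n` can be computed by a sequence of arithmetic
formulas of polynomial size", is the left-hand side verbatim. An equivalence of OPEN statements;
nothing is asserted. [cite: Burgisser2024Completeness, Cor. 2.19] -/
theorem Bur24_cor_2_19 :
    (IsPBounded fun n => formulaComplexity (detPoly (Fin n) k)) ↔
      ∀ {σ : ℕ → Type} (f : ∀ n, MvPolynomial (σ n) k),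
        IsVPwsFamily f ↔ IsPBounded fun n => formulaComplexity (f n) := by
  rw [← vbp_subset_vf_iff_isPBounded_formulaComplexity_detPoly]
  exact ⟨fun h _ f => ⟨h f, IsVPwsFamily.of_isPBounded_formulaComplexity⟩,
    fun h _ f hf => (h f).mp hf⟩

end Formulas

end Literature.Computability.AlgebraicComplexity
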